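import Summits.CriticalPhenomena.PercolationContinuityZ3.Theorems.PercNearOneGluingNoHeavyLowerTailSahiBlocksAllButOne
import Summits.CriticalPhenomena.PercolationContinuityZ3.Theorems.PercNearOneGluingNoHeavyLowerTailSahiAllButOneEvent

/-!
# `NoHeavyLowerTail` (crux stmt-CriticalPhenomena-4575), Sahi / Kahn positivity: ALL BLOCKS BUT ONE (VI) — event forms, all parameters

Support file (cell `prim-l12`, seat P3, gen 8; `--supports stmt-CriticalPhenomena-4575`).  No `sorry`, no named facts, standard axioms.
New mathematics (this programme).

The event forms of `…SahiBlocksAllButOne.sahiE_three_nonneg_of_aboH`.  For a block `e : Fin k ↪ ι` (`k ≥ 1`) and a block assignment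
`β : Fin k → Fin m` the sets `A_i = e '' (blk β i)` are pairwise disjoint finite sets of coordinates, and
`aboEvent e β = {ω : at most one of the A_i is not contained in ω}` ("all but at most one of the disjoint cylinders `{A_i ⊆ ω}` hold";
the read-once threshold function `Th_{m−1}(∧_{A_1}, …, ∧_{A_m})`).  Then for all increasing `U, V`:
* `sahiE_three_aboEvent_nonneg`: `E₃(1_{aboEvent}, 1_U, 1_V) ≥ 0` when the parameters are interior on the block;
* **`sahiE_three_aboEvent_nonneg'`: the same for EVERY `p : ι → [0,1]`** (closure argument `…SahiAllButOneEvent.sahiE_nonneg_of_interior`).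
* `sahiE_three_allButOneBlocks_nonneg`: the packaged form for an arbitrary family `B : Fin m → Finset ι` of pairwise disjoint sets of coordinates.
Special cases: `…SahiAllButOneEvent` (all `|A_i| = 1`), `…SahiOrCylindersEvent` (`m = 2`). [this work]
-/

noncomputable section

open scoped Classical

namespace Summit.CriticalPhenomena.PercolationContinuityZ3.Theorems

namespace SahiBlocksAllButOne

open Finset
open SahiHittingSlot SahiTransportCert
open Literature.Combinatorics.Sahi2008
open Literature.Probability.Percolation (DeterminedBy determinedBy_iff)
open Literature.Probability.Percolation.DecisionTree (ind ind_of_mem ind_of_not_mem ind_nonneg)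

variable {ι : Type} {k m : ℕ}

/-- The all-blocks-but-one event of a block `e` with block assignment `β`: at most one of the sets `e '' (blk β i)` is not open. [this work] -/
def aboEvent (e : Fin k ↪ ι) (β : Fin k → Fin m) : Set (Set ι) :=
  {ω | ∀ i j, ¬ ((e '' blk β i : Set ι) ⊆ ω) → ¬ ((e '' blk β j : Set ι) ⊆ ω) → i = j}

/-- It is increasing. [this work] -/
theorem isUpperSet_aboEvent (e : Fin k ↪ ι) (β : Fin k → Fin m) : IsUpperSet (aboEvent e β) :=
  fun _ _ hle hω i j hi hj => hω i j (fun h => hi (Set.Subset.trans h hle)) (fun h => hj (Set.Subset.trans h hle))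

/-- Containment of an image of a block depends only on the trace on the block. [this work] -/
theorem image_subset_iff_of_inter_eq (e : Fin k ↪ ι) (S : Set (Fin k)) {ω ω' : Set ι} (h : ω ∩ Set.range e = ω' ∩ Set.range e) :
    (e '' S : Set ι) ⊆ ω ↔ (e '' S : Set ι) ⊆ ω' := by
  constructor
  · rintro hS _ ⟨x, hx, rfl⟩
    have : e x ∈ ω ∩ Set.range e := ⟨hS ⟨x, hx, rfl⟩, ⟨x, rfl⟩⟩
    rw [h] at this; exact this.1
  · rintro hS _ ⟨x, hx, rfl⟩
    have : e x ∈ ω' ∩ Set.range e := ⟨hS ⟨x, hx, rfl⟩, ⟨x, rfl⟩⟩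
    rw [← h] at this; exact this.1

/-- The event is determined by the block. [this work] -/
theorem determinedBy_aboEvent (e : Fin k ↪ ι) (β : Fin k → Fin m) : DeterminedBy (aboEvent e β) (Set.range e) := by
  rw [determinedBy_iff]
  intro ω ω' h
  simp only [aboEvent, Set.mem_setOf_eq]
  constructor
  · intro H i j hi hj
    exact H i j (fun h' => hi ((image_subset_iff_of_inter_eq e _ h).1 h')) (fun h' => hj ((image_subset_iff_of_inter_eq e _ h).1 h'))
  · intro H i j hi hj
    exact H i j (fun h' => hi ((image_subset_iff_of_inter_eq e _ h).2 h')) (fun h' => hj ((image_subset_iff_of_inter_eq e _ h).2 h'))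

/-- Its pattern event is `aboH β`. [this work] -/
theorem pat_aboEvent (e : Fin k ↪ ι) (β : Fin k → Fin m) : pat e (aboEvent e β) = aboH β := by
  ext T
  simp only [pat, aboEvent, aboH, Set.mem_setOf_eq, Set.image_subset_image_iff e.injective]

/-- **The all-blocks-but-one slot theorem, event form** (interior parameters on the block). [this work] -/
theorem sahiE_three_aboEvent_nonneg [Fintype ι] (p : ι → unitInterval) (e : Fin k ↪ ι) (hk : 0 < k) (β : Fin k → Fin m)
    (hp : ∀ i, 0 < (p (e i) : ℝ) ∧ (p (e i) : ℝ) < 1) {U V : Set (Set ι)} (hU : IsUpperSet U) (hV : IsUpperSet V) :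
    0 ≤ sahiE (bernoulliWeight p) 3 ![ind (aboEvent e β), ind U, ind V] :=
  sahiE_three_nonneg_of_aboH p e hk hp β (determinedBy_aboEvent e β) (pat_aboEvent e β) hU hV

/-- **THE ALL-BLOCKS-BUT-ONE SLOT THEOREM FOR ALL PARAMETERS.**  For every block `e : Fin k ↪ ι` (`k ≥ 1`), every block assignment
`β : Fin k → Fin m`, every `p : ι → [0,1]` and all increasing `U, V`:
`E₃(1_{at most one of the e''(blk β i) is not open}, 1_U, 1_V) ≥ 0`. [this work] -/
theorem sahiE_three_aboEvent_nonneg' [Fintype ι] (p : ι → unitInterval) (e : Fin k ↪ ι) (hk : 0 < k) (β : Fin k → Fin m)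
    {U V : Set (Set ι)} (hU : IsUpperSet U) (hV : IsUpperSet V) :
    0 ≤ sahiE (bernoulliWeight p) 3 ![ind (aboEvent e β), ind U, ind V] :=
  SahiAllButOne.sahiE_nonneg_of_interior (Set.range e) _
    (fun p' hp' => sahiE_three_aboEvent_nonneg p' e hk β (fun i => hp' (e i) ⟨i, rfl⟩) hU hV) p


/-! ### Packaging: an arbitrary family of pairwise disjoint finite sets of coordinates -/

/-- **KAHN'S CONJECTURE 5 / SAHI'S `C₃` FOR THE FIRST SLOT "ALL BUT AT MOST ONE OF THE CYLINDERS `{B_i ⊆ ω}` HOLD"**, for every finite family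
`B : Fin m → Finset ι` of pairwise disjoint sets of coordinates, not all empty, every `p : ι → [0,1]`, all increasing `U, V`, every dimension. [this work] -/
theorem sahiE_three_allButOneBlocks_nonneg [Fintype ι] (p : ι → unitInterval) (B : Fin m → Finset ι)
    (hdisj : ∀ i j, i ≠ j → Disjoint (B i) (B j)) (hne : ∃ i, (B i).Nonempty) {U V : Set (Set ι)} (hU : IsUpperSet U) (hV : IsUpperSet V) :
    0 ≤ sahiE (bernoulliWeight p) 3
      ![ind {ω : Set ι | ∀ i j, ¬ ((↑(B i) : Set ι) ⊆ ω) → ¬ ((↑(B j) : Set ι) ⊆ ω) → i = j}, ind U, ind V] := by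
  -- enumerate `A = ⋃ B_i`
  set A : Finset ι := univ.biUnion B with hA
  set k := A.card with hk
  let f : Fin k ≃ ↥A := (Finset.equivFinOfCardEq rfl).symm
  let e : Fin k ↪ ι := ⟨fun x => (f x : ι), fun x y h => f.injective (Subtype.ext h)⟩
  have hmemA : ∀ x : Fin k, ∃ i, (e x : ι) ∈ B i := fun x => by
    have hx : (f x : ι) ∈ univ.biUnion B := (f x).2
    rw [mem_biUnion] at hx
    obtain ⟨i, _, hi⟩ := hx
    exact ⟨i, hi⟩
  -- the block assignment
  let β : Fin k → Fin m := fun x => Classical.choose (hmemA x)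
  have hβ : ∀ x, (e x : ι) ∈ B (β x) := fun x => Classical.choose_spec (hmemA x)
  have hβeq : ∀ x i, (e x : ι) ∈ B i → β x = i := fun x i hi => by
    by_contra hne'
    exact Finset.disjoint_left.1 (hdisj _ _ hne') (hβ x) hi
  have himg : ∀ i, (e '' blk β i : Set ι) = ↑(B i) := by
    intro i
    ext y
    constructor
    · rintro ⟨x, hx, rfl⟩
      have hx' : β x = i := hx
      rw [← hx']; exact hβ x
    · intro hy
      have hyA : y ∈ A := by rw [hA, mem_biUnion]; exact ⟨i, mem_univ i, hy⟩
      refine ⟨f.symm ⟨y, hyA⟩, ?_, by simp [e]⟩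
      show β (f.symm ⟨y, hyA⟩) = i
      apply hβeq
      simpa [e] using hy
  have hkpos : 0 < k := by
    obtain ⟨i, y, hy⟩ := hne
    exact Finset.card_pos.2 ⟨y, by rw [hA, mem_biUnion]; exact ⟨i, mem_univ i, hy⟩⟩
  have hev : aboEvent e β = {ω : Set ι | ∀ i j, ¬ ((↑(B i) : Set ι) ⊆ ω) → ¬ ((↑(B j) : Set ι) ⊆ ω) → i = j} := by
    ext ω; simp only [aboEvent, Set.mem_setOf_eq, himg]
  rw [← hev]
  exact sahiE_three_aboEvent_nonneg' p e hkpos β hU hV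

end SahiBlocksAllButOne

end Summit.CriticalPhenomena.PercolationContinuityZ3.Theorems
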